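import Mathlib.LinearAlgebra.Matrix.ToLin
import Mathlib.LinearAlgebra.Trace
import Literature.RepresentationTheory.FiniteGroups.BrauerTheorem
import HarnessLib

/-!
# Monomial representations: the representation induced by a character of degree one
(Serre, *Linear Representations of Finite Groups*, §3.3 with Thm. 12, §7.1 Example; Neukirch
VII (10.2) a))

Topic `Literature/RepresentationTheory/FiniteGroups`.  For a subgroup `H ≤ G` and a
homomorphism `θ : H → kˣ` (a character of degree `1` of `H`) the **monomial representation**
`Ind_H^G θ` (Serre §7.1, Example: "When the `W_i` are of dimension 1, the representation `V`
is said to be monomial") has the explicit model on the free module `k^{G/H}` with basis the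
left cosets `e_σ`, `σ ∈ G/H` (Serre §3.3, Definition "`V = ⊕_{σ ∈ G/H} W_σ`" and Example 2, the
case `θ = 1`): `y · e_{rH} = θ(t) e_{r'H}` where `y r = r' t`, `t ∈ H`, `r`, `r'` the chosen
representatives ("each `s ∈ G` can be written uniquely `s = rt`").  This file constructs it
and proves the two facts about it used for Artin L-functions (Brauer's factorisation
`Literature.NumberTheory.Automorphic.brauer_artinLFunction_eq_prod_zpow`):

* `Literature.RepTheory.monomialRep H θ : Representation k G (G ⧸ H → k)` (via the cocycle
  `monomialCocycle H y q = q̇⁻¹ y (y⁻¹q)̇ ∈ H`, `q̇ = Quotient.out q`), with `monomialRep_apply`,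
  `monomialRep_single` (action on the coset basis), `monomialRep_single_one_of_mem`
  (`e_{H}` is a `θ`-eigenvector of `H`), `exists_monomialRep_out_single_one` and
  `eq_top_of_forall_monomialRep_single_one_mem` (the translates of `e_H` span);
* `Literature.RepresentationTheory.FiniteGroups.character_monomialRep` (**proved**; Serre §3.3 Thm. 12,
  `χ_ρ(u) = ∑_{r ∈ R, r⁻¹ur ∈ H} χ_θ(r⁻¹ur) = (1/h) ∑_{s ∈ G, s⁻¹us ∈ H} χ_θ(s⁻¹us)`, for `W`
  of degree `1`; restated as §7.2 Prop. 20 (ii)): the character of `monomialRep H θ` is the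
  induced class function `Ind_H^G θ` (`Literature.RepresentationTheory.FiniteGroups.indClassFun`,
  `indClassFun_eq_sum_quotient`): in the coset basis `ρ(u)` is a monomial matrix whose
  diagonal entries sit at the cosets `q` fixed by `u`, where they equal `θ(q̇⁻¹ u q̇)` (Serre's
  proof: "the indices `r` such that `r_u ≠ r` give zero diagonal terms").

## Mathlib search

Mathlib (this pin) has `Representation.ind` / `IndV` (the tensor model `k[G] ⊗_{k[H]} W` as
coinvariants, `RepresentationTheory/Induced.lean`), `Representation.coind`, `Rep.indCoindIso`,
`Representation.ofMulAction` (the permutation representation on `G ⧸ H`, i.e. the case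
`θ = 1`), but no monomial model for a non-trivial `θ` and no character formula for induced
representations (`lean search 'monomial.*Representation|character_ind|ind_character'`: nothing
relevant).  The recognition theorem `Literature.RepresentationTheory.FiniteGroups.nonempty_equiv_ind`
(`InducedRecognition`) identifies `monomialRep H θ` with `Representation.ind H.subtype θ` when
needed; here only the explicit model is used.

## References

* J.-P. Serre, *Linear Representations of Finite Groups*, GTM 42 (1977), §3.3 (induced
  representations: Definition, Example 2, Thm. 12 — the character of an induced
  representation), §7.1 Example (monomial representations), §7.2 Prop. 20
  (`SerreLinearRepresentations1977`).
* J. Neukirch, *Algebraic Number Theory* (1999), VII (10.2) a) (`NeukirchANT1999`).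
-/

noncomputable section

open scoped BigOperators
open Module

namespace Literature.RepresentationTheory.FiniteGroups

section Cocycle

variable {G : Type*} [Group G] (H : Subgroup G)

/-- A coset `q ∈ G/H` is fixed by `y` iff `q̇⁻¹ y q̇ ∈ H` for its chosen representative
`q̇ = q.out`. [folklore] -/
theorem smul_eq_self_iff_mem (y : G) (q : G ⧸ H) : y • q = q ↔ q.out⁻¹ * y * q.out ∈ H := by
  have h1 : (y • q : G ⧸ H) = QuotientGroup.mk (y * q.out) := by
    conv_lhs => rw [← QuotientGroup.out_eq' q]
    rfl
  calc y • q = q ↔ QuotientGroup.mk (y * q.out) = (QuotientGroup.mk q.out : G ⧸ H) := by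
        rw [h1, QuotientGroup.out_eq']
    _ ↔ (y * q.out)⁻¹ * q.out ∈ H := QuotientGroup.eq
    _ ↔ q.out⁻¹ * y * q.out ∈ H := by
        rw [show q.out⁻¹ * y * q.out = ((y * q.out)⁻¹ * q.out)⁻¹ by group, Subgroup.inv_mem_iff]

/-- The defining relation of the cocycle: `q̇⁻¹ · y · (y⁻¹ q)̇ ∈ H` (both `q̇` and `y (y⁻¹q)̇`
represent the coset `q`). [folklore] -/
theorem out_inv_mul_mul_out_mem (y : G) (q : G ⧸ H) : q.out⁻¹ * y * (y⁻¹ • q).out ∈ H := by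
  rw [mul_assoc, ← QuotientGroup.eq, QuotientGroup.out_eq']
  have : (QuotientGroup.mk (y * (y⁻¹ • q).out) : G ⧸ H) = y • QuotientGroup.mk ((y⁻¹ • q).out) := rfl
  rw [this, QuotientGroup.out_eq', smul_inv_smul]

/-- The **cocycle of the monomial representation**: for `y ∈ G` and a coset `q ∈ G/H`, the
element `q̇⁻¹ y (y⁻¹ q)̇` of `H` (with `q̇ = q.out` the chosen representatives), i.e. the
`H`-component `t` of `y · (y⁻¹q)̇ = q̇ · t` (Serre §3.3, proof of Thm. 12: "if we write `ur` in
the form `r_u t` with `r_u ∈ R` and `t ∈ H`").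
[cite: SerreLinearRepresentations1977, §3.3, proof of Thm. 12] -/
def monomialCocycle (y : G) (q : G ⧸ H) : H :=
  ⟨q.out⁻¹ * y * (y⁻¹ • q).out, out_inv_mul_mul_out_mem H y q⟩

/-- Unfolding lemma for the cocycle. [folklore] -/
@[simp] theorem coe_monomialCocycle (y : G) (q : G ⧸ H) :
    (monomialCocycle H y q : G) = q.out⁻¹ * y * (y⁻¹ • q).out := rfl

/-- The cocycle at a translated coset: `c(y, y q) = (yq)̇⁻¹ y q̇`. [folklore] -/
theorem coe_monomialCocycle_smul (y : G) (q : G ⧸ H) :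
    (monomialCocycle H y (y • q) : G) = (y • q).out⁻¹ * y * q.out := by
  rw [coe_monomialCocycle, inv_smul_smul]

/-- The cocycle is trivial at `y = 1`. [folklore] -/
@[simp] theorem monomialCocycle_one (q : G ⧸ H) : monomialCocycle H 1 q = 1 :=
  Subtype.ext (by simp)

/-- **The cocycle identity** `c(yz, q) = c(y, q) · c(z, y⁻¹ q)`. [folklore] -/
theorem monomialCocycle_mul (y z : G) (q : G ⧸ H) :
    monomialCocycle H (y * z) q = monomialCocycle H y q * monomialCocycle H z (y⁻¹ • q) :=
  Subtype.ext (by simp only [coe_monomialCocycle, Subgroup.coe_mul, mul_inv_rev, mul_smul]; group)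

/-- At a fixed coset (`y q = q`) the cocycle is `q̇⁻¹ y q̇`. [folklore] -/
theorem coe_monomialCocycle_of_smul_eq (y : G) (q : G ⧸ H) (hq : y • q = q) :
    (monomialCocycle H y q : G) = q.out⁻¹ * y * q.out := by
  rw [coe_monomialCocycle, inv_smul_eq_iff.mpr hq.symm]

end Cocycle

section Rep

variable {k : Type*} [CommRing k] {G : Type*} [Group G] (H : Subgroup G) (θ : H →* kˣ)

/-- The endomorphism `f ↦ (q ↦ θ(c(y, q)) f(y⁻¹ q))` of `k^{G/H}` by which `y` acts in the
monomial representation. [cite: SerreLinearRepresentations1977, §3.3] -/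
def monomialRepMap (y : G) : (G ⧸ H → k) →ₗ[k] (G ⧸ H → k) :=
  LinearMap.pi fun q => (θ (monomialCocycle H y q) : k) • LinearMap.proj (y⁻¹ • q)

/-- Unfolding lemma for `monomialRepMap`. [folklore] -/
@[simp] theorem monomialRepMap_apply (y : G) (f : G ⧸ H → k) (q : G ⧸ H) :
    monomialRepMap H θ y f q = (θ (monomialCocycle H y q) : k) * f (y⁻¹ • q) := by
  simp [monomialRepMap]

/-- The **monomial representation** `Ind_H^G θ` of `G` induced by the character `θ : H → kˣ`
of degree one, on the free module `k^{G/H}` on the left cosets: `(y · f)(q) = θ(c(y, q)) f(y⁻¹ q)`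
with the cocycle `c(y, q) = q̇⁻¹ y (y⁻¹q)̇ ∈ H`; on the coset basis,
`y · e_q = θ((yq)̇⁻¹ y q̇) e_{yq}` (`monomialRep_single`).  This is Serre's
`V = ⊕_{σ ∈ G/H} W_σ` (§3.3, Definition; Example 2 is the case `θ = 1`, `ρ_s e_σ = e_{sσ}`) for
`W = k` with `H` acting by `θ` (§7.1, Example: "monomial").
[cite: SerreLinearRepresentations1977, §3.3 Definition and Example 2; §7.1 Example]
[cite: NeukirchANT1999, VII (10.2) a)] -/
def monomialRep : Representation k G (G ⧸ H → k) where
  toFun := monomialRepMap H θ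
  map_one' := by
    refine LinearMap.ext fun f => funext fun q => ?_
    simp
  map_mul' y z := by
    refine LinearMap.ext fun f => funext fun q => ?_
    simp only [monomialRepMap_apply, Module.End.mul_apply, monomialCocycle_mul, map_mul,
      Units.val_mul, mul_inv_rev, mul_smul, mul_assoc]

/-- Unfolding lemma for the monomial representation. [folklore] -/
@[simp] theorem monomialRep_apply (y : G) (f : G ⧸ H → k) (q : G ⧸ H) :
    monomialRep H θ y f q = (θ (monomialCocycle H y q) : k) * f (y⁻¹ • q) :=
  monomialRepMap_apply H θ y f q

/-- **Action on the coset basis**: `y · e_q = θ((yq)̇⁻¹ y q̇) · e_{yq}` (Serre §3.3: `ρ_s`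
permutes the `W_σ`). [cite: SerreLinearRepresentations1977, §3.3] -/
theorem monomialRep_single [DecidableEq (G ⧸ H)] (y : G) (q : G ⧸ H) :
    monomialRep H θ y (Pi.single q 1) =
      (θ (monomialCocycle H y (y • q)) : k) • Pi.single (y • q) (1 : k) := by
  funext q'
  rw [monomialRep_apply, Pi.smul_apply, smul_eq_mul]
  by_cases hq' : q' = y • q
  · subst hq'
    rw [inv_smul_smul, Pi.single_eq_same, Pi.single_eq_same]
  · have hne : y⁻¹ • q' ≠ q := fun h => hq' (by rw [← h, smul_inv_smul])
    rw [Pi.single_eq_of_ne hne, Pi.single_eq_of_ne hq', mul_zero, mul_zero]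

/-- **`e_H` is a `θ`-eigenvector of `H`**: `h · e_H = θ(h) e_H` for `h ∈ H` (the subspace
`W = k e_H` is the copy of `θ` from which the representation is induced, Serre §3.3).
[cite: SerreLinearRepresentations1977, §3.3] -/
theorem monomialRep_single_one_of_mem [DecidableEq (G ⧸ H)] (h : H) :
    monomialRep H θ h (Pi.single ((1 : G) : G ⧸ H) 1) =
      (θ h : k) • Pi.single ((1 : G) : G ⧸ H) (1 : k) := by
  set q₁ : G ⧸ H := ((1 : G) : G ⧸ H) with hq₁
  have hfix : (h : G) • q₁ = q₁ := by
    rw [hq₁]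
    change (QuotientGroup.mk ((h : G) * 1) : G ⧸ H) = QuotientGroup.mk 1
    rw [mul_one, QuotientGroup.eq, mul_one, Subgroup.inv_mem_iff]
    exact h.2
  rw [monomialRep_single, hfix]
  congr 2
  -- `θ(q̇₁⁻¹ h q̇₁) = θ(h)` since `q̇₁ ∈ H` and `kˣ` is commutative
  have hout : q₁.out ∈ H := by
    have : (QuotientGroup.mk q₁.out : G ⧸ H) = QuotientGroup.mk 1 := by rw [QuotientGroup.out_eq', hq₁]
    rw [QuotientGroup.eq, mul_one, Subgroup.inv_mem_iff] at this
    exact this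
  have hc : monomialCocycle H (h : G) q₁ = ⟨q₁.out, hout⟩⁻¹ * h * ⟨q₁.out, hout⟩ :=
    Subtype.ext (by rw [coe_monomialCocycle_of_smul_eq H _ _ hfix]; rfl)
  rw [hc, map_mul, map_mul, map_inv, inv_mul_cancel_comm]

/-- Every basis vector `e_q` is, up to a unit, a translate of `e_H`: `q̇ · e_H = θ(·) e_q`.
[cite: SerreLinearRepresentations1977, §3.3] -/
theorem exists_monomialRep_out_single_one [DecidableEq (G ⧸ H)] (q : G ⧸ H) :
    ∃ h : H, monomialRep H θ q.out (Pi.single ((1 : G) : G ⧸ H) 1) = (θ h : k) • Pi.single q (1 : k) := by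
  refine ⟨monomialCocycle H q.out (q.out • ((1 : G) : G ⧸ H)), ?_⟩
  rw [monomialRep_single]
  have : q.out • ((1 : G) : G ⧸ H) = q := by
    change (QuotientGroup.mk (q.out * 1) : G ⧸ H) = q
    rw [mul_one, QuotientGroup.out_eq']
  rw [this]

/-- **The translates of `e_H` span `k^{G/H}`** (Serre §3.3: `V = ∑_σ W_σ`): a submodule
containing all `y · e_H` is everything. [cite: SerreLinearRepresentations1977, §3.3] -/
theorem eq_top_of_forall_monomialRep_single_one_mem [DecidableEq (G ⧸ H)] [Finite (G ⧸ H)]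
    (S : Submodule k (G ⧸ H → k))
    (hS : ∀ y : G, monomialRep H θ y (Pi.single ((1 : G) : G ⧸ H) 1) ∈ S) : S = ⊤ := by
  classical
  haveI : Fintype (G ⧸ H) := Fintype.ofFinite _
  rw [eq_top_iff]
  rintro f -
  rw [← Finset.univ_sum_single f]
  refine S.sum_mem fun q _ => ?_
  obtain ⟨h, hh⟩ := exists_monomialRep_out_single_one H θ q
  have hq : Pi.single q (f q) = (f q * ((θ h)⁻¹ : kˣ)) • monomialRep H θ q.out (Pi.single ((1 : G) : G ⧸ H) 1) := by
    rw [hh, smul_smul, mul_assoc, Units.inv_mul, mul_one]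
    funext q'
    by_cases hq' : q' = q
    · subst hq'; simp
    · simp [Pi.single_eq_of_ne hq']
  rw [hq]
  exact S.smul_mem _ (hS _)

/-- `dim k^{G/H} = (G : H)` (Serre §3.3: `dim V = (G:H) dim W`). [cite: SerreLinearRepresentations1977, §3.3] -/
theorem finrank_quotient_fun {K : Type*} [Field K] [Finite (G ⧸ H)] :
    Module.finrank K (G ⧸ H → K) = H.index := by
  classical
  haveI : Fintype (G ⧸ H) := Fintype.ofFinite _
  rw [Module.finrank_fintype_fun_eq_card, Subgroup.index_eq_card, Nat.card_eq_fintype_card]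

end Rep

/-! ### The character of the monomial representation -/

section Character

variable {G : Type} [Group G] [Fintype G] (H : Subgroup G) (θ : H →* ℂˣ)

omit [Fintype G] in
/-- A character of degree one is a class function on `H` (`ℂˣ` is commutative). [folklore] -/
theorem isClassFun_coe_monoidHom : IsClassFun (fun h : H => (θ h : ℂ)) := fun s t => by
  show ((θ (t * s * t⁻¹) : ℂˣ) : ℂ) = θ s
  rw [map_mul, map_mul, map_inv, mul_inv_cancel_comm]

/-- **The character of the monomial representation is the induced class function**
(Serre, *Linear Representations*, §3.3 Thm. 12: "`χ_ρ(u) = ∑_{r ∈ R, r⁻¹ur ∈ H} χ_θ(r⁻¹ur)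
= (1/h) ∑_{s ∈ G, s⁻¹us ∈ H} χ_θ(s⁻¹us)`" for `(V, ρ)` induced by `(W, θ)`, here `W = θ` of
degree one; §7.2 Prop. 20 (ii); Neukirch VII (10.2) a) uses exactly this `χ_*`).  In the
coset basis, `ρ(u)` is monomial: its diagonal entry at `e_q` is `θ(q̇⁻¹ u q̇)` if `u q = q` and
`0` otherwise ("the indices `r` such that `r_u ≠ r` give zero diagonal terms"), and
`Ind θ (u) = ∑_{q ∈ G/H, q̇⁻¹ u q̇ ∈ H} θ(q̇⁻¹ u q̇)` (`indClassFun_eq_sum_quotient`).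
[cite: SerreLinearRepresentations1977, §3.3 Thm. 12] -/
theorem character_monomialRep :
    (monomialRep H θ).character = indClassFun H (fun h => (θ h : ℂ)) := by
  classical
  funext y
  rw [indClassFun_eq_sum_quotient H (isClassFun_coe_monoidHom H θ) y, Representation.character,
    LinearMap.trace_eq_matrix_trace ℂ (Pi.basisFun ℂ (G ⧸ H)), Matrix.trace]
  refine Finset.sum_congr rfl fun q _ => ?_
  rw [Matrix.diag_apply, LinearMap.toMatrix_apply, Pi.basisFun_apply, Pi.basisFun_repr,
    monomialRep_single, Pi.smul_apply, smul_eq_mul]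
  by_cases hq : y • q = q
  · rw [hq, Pi.single_eq_same, mul_one]
    have hmem : q.out⁻¹ * y * q.out ∈ H := (smul_eq_self_iff_mem H y q).mp hq
    rw [show q.out⁻¹ * y * q.out = ((⟨_, hmem⟩ : H) : G) from rfl, extend_subtypeVal_apply]
    congr 2
    exact Subtype.ext (coe_monomialCocycle_of_smul_eq H y q hq)
  · rw [Pi.single_eq_of_ne (Ne.symm hq), mul_zero,
      extend_subtypeVal_of_not_mem H _ (fun hm => hq ((smul_eq_self_iff_mem H y q).mpr hm))]

/-- The character of the monomial representation is a character of `G` in the sense of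
`IsCharacter`, equal to `Ind_H^G θ`; in particular `Ind_H^G θ` is a character. [folklore] -/
theorem isCharacter_indClassFun_monoidHom : IsCharacter G (indClassFun H (fun h => (θ h : ℂ))) :=
  ⟨G ⧸ H → ℂ, _, _, inferInstance, monomialRep H θ, character_monomialRep H θ⟩

end Character

end Literature.RepresentationTheory.FiniteGroups

end
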